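import Summits.Langlands.Langlands.Statement
import Literature.NumberTheory.Automorphic.IsAutomorphicAE
import Literature.NumberTheory.GaloisRepresentations.HeckeCharacter
import HarnessLib

/-!
# F4 `_onpath` — the rung is a consequence of the summit (line `QuarticInducedCharacterReciprocity`, crux
`ReciprocityUpToIrreducibility`, item stmt-Langlands-14328; G4 ladder-down generation 19)

`QuarticInducedCharacterReciprocity_of_Langlands : Langlands → QuarticInducedCharacterReciprocity` (tagged
`@[aesop safe apply]`): clause (B) of `Langlands` over the top field `F` (for the reciprocity datum the summit's
non-vacuity conjunct provides) applied to the irreducible geometric `ρ` of the family; `Corresponds` restricted to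
its a.e. Satake clause.  Proved for every degree `d` (`inducedCharacterReciprocity_of_langlands`).  No `sorry`.
-/

noncomputable section

set_option linter.dupNamespace false

open scoped MatrixGroups Matrix NumberField Classical Polynomial
open Filter IsDedekindDomain Field Polynomial NumberField
open Literature.NumberTheory.Automorphic Literature.NumberTheory.GaloisRepresentations
open Literature.NumberTheory.PAdicHodge
open Summit.Langlands

namespace Summit.Langlands.Langlands.Cruxes.ReciprocityUpToIrreducibility.QuarticInducedCharacterReciprocity

/-- **The RUNG FAMILY, dial = induction degree `d = [E:F]`** (verbatim the skeleton's): induced-character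
reciprocity along arbitrary degree-`d` extensions (clause (B), a.e. Satake form, on the sector of irreducible geometric
`ρ : Γ_F → GL_d(ℚ̄_ℓ)` whose Frobenius polynomials are the induced polynomials of a unitary Hecke character `θ` of a
degree-`d` extension `E/F`, ANY Galois closure, ANY number field `F`). -/
def InducedCharacterReciprocity (d : ℕ) : Prop :=
  ∀ (F E : Type) [Field F] [NumberField F] [Field E] [NumberField E] [Algebra F E],
    Module.finrank F E = d →
    ∀ (θ : HeckeCharacter E), θ.IsUnitary →
      ∀ (hF : isCompact_glFiniteIntegralLevel d F) (ℓ : ℕ) [Fact ℓ.Prime] (ι : PadicAlgCl ℓ ≃+* ℂ)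
        (ρ : FramedGaloisRep F (PadicAlgCl ℓ) d),
        ρ.toGaloisRep.IsIrreducible →
        (∀ (w : HeightOneSpectrum (𝓞 F)) (hw : ((ℓ : ℕ) : 𝓞 F) ∈ w.asIdeal),
            (fontainePstAdicCompletion w ℓ hw).IsDeRhamFramed (ρ.toLocal w)) →
        (∀ᶠ v : HeightOneSpectrum (𝓞 F) in cofinite, ρ.IsUnramifiedAt v ∧
            ∀ α : Multiset ℂ, satakePolynomial α =
                ∏ᶠ w ∈ {w : HeightOneSpectrum (𝓞 E) | w.under (𝓞 F) = v},
                  (X ^ w.asIdeal.inertiaDeg (𝓞 F) - C (θ.valueAtUniformizer w)) →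
              ρ.HasFrobCharpolyAt v (arithFrobPolyOfSatake ι v.residueCard 1 α)) →
        ∃ π : AutomorphicRepData (AutomorphyDatum.gl d F hF), SatakeFrobCompatibleAE ι π ρ

/-- **THE RUNG (θ21 = 4)**: induced-character reciprocity along ARBITRARY QUARTIC extensions (open core: primitive
quartics, Galois closure `A₄ / S₄`). -/
def QuarticInducedCharacterReciprocity : Prop := InducedCharacterReciprocity 4

/-- `Langlands → InducedCharacterReciprocity d` for every `d`. -/
theorem inducedCharacterReciprocity_of_langlands (d : ℕ) (hL : _root_.Langlands) :
    InducedCharacterReciprocity d := by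
  intro F E _ _ _ _ _ hd θ _hθ hF ℓ _ ι ρ hirr hdR hfrob
  obtain ⟨⟨Rec⟩, hall⟩ := hL F
  have hd0 : 0 < d := hd ▸ Module.finrank_pos
  have hB : GaloisToAutomorphic d Rec hF := (hall Rec d hd0 hF).2
  have hgeo : IsGeometricFramed Rec ρ := ⟨hfrob.mono fun v hv => hv.1, fun w hw => hdR w hw⟩
  obtain ⟨π, _hLalg, hcorr⟩ := hB ℓ ι ρ hirr hgeo
  exact ⟨π.1, hcorr.1⟩

/-- **F4 on-path lemma**: `S → Rung`. -/
@[aesop safe apply]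
theorem QuarticInducedCharacterReciprocity_of_Langlands (hL : _root_.Langlands) :
    QuarticInducedCharacterReciprocity :=
  inducedCharacterReciprocity_of_langlands 4 hL

end Summit.Langlands.Langlands.Cruxes.ReciprocityUpToIrreducibility.QuarticInducedCharacterReciprocity

end
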